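import Literature.NumberTheory.EllipticCurves.Sprung2017.SharpFlatFunctionalEquationApZeroWeightsProofs
import HarnessLib

/-!
# Sprung 2017, Cor. 4.14 at `a_p = 0`: the functional equation of the pair `(L♯, L♭)` at an ODD
# supersingular prime — PROOF of the named fact `cor414_sharpFlat_functionalEquation_apZero`
# (part 2: transport of the Mazur–Tate congruences under `T ↦ T^ι`, uniqueness of the pair)

A *proofs* companion (theorems only; no definition, no named fact) of `SharpFlatFunctionalEquation` (the
fact) and `SharpFlatFunctionalEquationApZeroWeightsProofs` (part 1: the `ι`-weights `⌊pⁿ/(p+1)⌋` of the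
chromatic polynomials `u_n`, `v_n` at `a_p = 0` and their interpolation by `a = −p/(p+1)`,
`b = −1/(p+1)`). It ports §§6–7 of the tree's `p = 2` THEOREM
(`Literature/Barriers/BirchSwinnertonDyer/PAdicFunctionalEquationSharpFlatTwoProofs`) to an arbitrary
prime, on top of the general finite-level functional equation of Sprung's combination
`Y_n = u_n L♯ + v_n L♭` (`IsSprungPair.exists_subst_sub_mul_eq_omega_mul`,
`SharpFlatCombinationFunctionalEquationProofs`; Mazur–Tate–Teitelbaum §I.17 at finite level).

## The proof (finite level + uniqueness; not Sprung's route through the completed `L̂♯, L̂♭`)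

For a Sprung pair `(L♯, L♭)` at trace `0` and every level `n`: `Y_n(T^ι) − σ(1+T)^c Y_n ∈ ω_n Λ`
(the combination functional equation, integral plus symbols); at odd `n`, `Y_n = u_n L♯`
(`v_n = 0`) with `u_n(T^ι) = E^{d_n} u_n`, `d_n = ⌊pⁿ/(p+1)⌋ ≡ a (mod pⁿ)`, so
`u_n · σ(1+T)^{−(c+a)} L♯(T^ι) ≡ u_n · L♯ (mod ω_n)` (§6 `exists_sharp_transport_apZero`); likewise
at even `n` for `L♭` with `b`. Hence `(σ(1+T)^{−(c+a)}L♯(T^ι), σ(1+T)^{−(c+b)}L♭(T^ι))` is again a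
Sprung pair (`isSprungPair_zero_transport`, using §5: a congruence `θ ≡ ω·L (mod ω_n)` depends only
on `ω·L mod ω_n Λ`), and the uniqueness of the pair (`IsSprungPair.unique`, Sprung Thm. 1.12) gives
`L♯ = σ(1+T)^{−(c+a)}L♯(T^ι)`, i.e. `L♯(T^ι) = σ(1+T)^{c+a}L♯` (`σ² = 1`), and the same for `L♭`.

* `cor414_sharpFlat_functionalEquation_apZero_holds` — **the named fact is a THEOREM** (net debt −1):
  its consumers (`cor414_sharpFlat_functionalEquation_apZero.span_eq`; the parity-stratum theorems of
  crux item stmt-BirchSwinnertonDyer-19001, `Summit.…Theorems.LargeImageParityStratum.*`; the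
  trace-functional-equation road of item stmt-BirchSwinnertonDyer-19875) become unconditional in this
  input by feeding `…_holds`. The `T^ι` binder of the fact is any `ι` with `(1+T)(1+ι) = 1`
  (`eq_invOnePlusSubOne_of_one_add_X_mul`: it is `invOnePlusSubOne`).

HONEST FRAMING: a published theorem (Sprung 2017, Cor. 4.14, `a_p = 0`, `i = 0`, odd `p`) proved in the
tree; BSD is not proved by any of this. Written by the lead prover of crux `KobayashiLowerHalfLargeImage`
(fact claim #1 on `cor414_sharpFlat_functionalEquation_apZero`).

## References

* F. Sprung, *On pairs of `p`-adic `L`-functions for weight-two modular forms*, Algebra & Number Theory 11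
  (2017): Thm. 1.12 (uniqueness), Cor. 4.4 (the congruences), Cor. 4.10 (integrality), §3.5 (`W^±`),
  Thm. 4.13 / Cor. 4.14 (functional equation). [Sprung2017]
* R. Pollack, Duke Math. J. 118 (2003), Thm. 5.13 (the statement corrected by Cor. 4.14), Prop. 6.18. [Pollack2003]
* B. Mazur, J. Tate, J. Teitelbaum, Invent. Math. 84 (1986), §I.17. [MazurTateTeitelbaum1986Invent]
* R. Greenberg, LNM 1716 (1999), §1 (pp. 67–68: `T^ι`, `⟨N⟩ = γ^c`, the sign). [GreenbergLNM1716]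
-/

set_option autoImplicit false

noncomputable section

open scoped MatrixGroups ModularForm

open CongruenceSubgroup PowerSeries Literature.NumberTheory.EllipticCurves.ModularForms
  Literature.Barriers.BirchSwinnertonDyer

namespace Literature.NumberTheory.EllipticCurves.Sprung2017

/-! ## §0. Plumbing carried over from part 1 (private there) -/

section Plumbing

variable {R : Type*} [CommRing R] (p : ℕ)

/-- `(1+T)^k · E^k = 1` (private plumbing). [folklore] -/
private theorem one_add_X_pow_mul_E_pow (k : ℕ) :
    (1 + X : R⟦X⟧) ^ k * (invOnePlusSubOne + 1) ^ k = 1 := by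
  rw [← mul_pow, one_add_X_mul_invOnePlusSubOne_add_one, one_pow]

/-- At `a_p = 0`: `x_n = 0` propagates two steps (private plumbing). [folklore] -/
private theorem sprungSeq_zero_eq_zero_of_eq_zero (x₀ x₁ : Polynomial ℤ) {n : ℕ}
    (h : sprungSeq 0 p x₀ x₁ n = 0) : sprungSeq 0 p x₀ x₁ (n + 2) = 0 := by
  rw [sprungSeq_add_two, h, Polynomial.C_0, zero_mul, mul_zero, sub_zero]

/-- `u_{2k} = 0` at `a_p = 0`. [cite: Sprung2017, §4 (the case a_p = 0)] -/
private theorem sharpPoly_zero_of_even' (k : ℕ) : sharpPoly 0 p (2 * k) = 0 := by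
  induction k with
  | zero => rfl
  | succ k ih =>
    rw [show 2 * (k + 1) = 2 * k + 2 by ring]
    exact sprungSeq_zero_eq_zero_of_eq_zero p 0 1 ih

/-- `v_{2k+1} = 0` at `a_p = 0`. [cite: Sprung2017, §4 (the case a_p = 0)] -/
private theorem flatPoly_zero_of_odd' (k : ℕ) : flatPoly 0 p (2 * k + 1) = 0 := by
  induction k with
  | zero => rfl
  | succ k ih =>
    rw [show 2 * (k + 1) + 1 = (2 * k + 1) + 2 by ring]
    exact sprungSeq_zero_eq_zero_of_eq_zero p 1 0 ih


end Plumbing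

/-! ## §5. Moving a congruence modulo `ω_n` along `Λ` -/

section Congr

variable {p : ℕ} [Fact p.Prime]

/-- `toIwasawa` is the coercion of the mapped polynomial (private plumbing). [folklore] -/
private theorem toIwasawa_eq_coe (q : Polynomial ℤ) :
    toIwasawa p q = ((q.map (Int.castRingHom ℤ_[p]) : Polynomial ℤ_[p]) : ℤ_[p]⟦X⟧) := rfl

/-- **A congruence `θ ≡ ω·L (mod ω_n)` only depends on `ω·L` modulo `ω_n Λ`**: if
`IsCongrModOmega p n θ ω L` and `ω·L' − ω·L ∈ ω_n Λ` then `IsCongrModOmega p n θ ω L'`.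
[cite: Pollack2003, Prop. 6.18 (shape of the congruences)] -/
theorem _root_.Literature.NumberTheory.EllipticCurves.IsCongrModOmega.of_sub_eq_omega_mul {n : ℕ} {θ : Polynomial ℚ} {ω : Polynomial ℤ}
    {L L' d : IwasawaAlgebra p} (h : IsCongrModOmega p n θ ω L)
    (hd : toIwasawa p ω * L' - toIwasawa p ω * L =
      (((cyclotomicOmega p n).map (Int.castRingHom ℤ_[p]) : Polynomial ℤ_[p]) : ℤ_[p]⟦X⟧) * d) :
    IsCongrModOmega p n θ ω L' := by
  obtain ⟨m, q, hq⟩ := h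
  refine ⟨m, q - (p : IwasawaAlgebra p) ^ m * d, ?_⟩
  have hd' := congrArg (iwasawaToPowerSeries p) hd
  rw [toIwasawa_eq_coe] at hd'
  simp only [map_sub, map_mul, map_pow, map_natCast] at hd' hq ⊢
  linear_combination hq - (p : ℚ_[p]⟦X⟧) ^ m * hd'

end Congr

/-! ## §6. Transport of the Mazur–Tate congruences under `T ↦ T^ι` at `a_p = 0` -/

section Transport

variable {N : ℕ} [NeZero N] {f : CuspForm (Gamma0 N) 2} {p : ℕ} [hp : Fact p.Prime]

/-- The `♯`-half of the transport, level by level: with `L' = σ·(1+T)^{−(c+a)}·L♯(T^ι)`,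
`u_m·L' − u_m·L♯ ∈ ω_m Λ` for every `m` (trivial at even `m`, where `u_m = 0`; at odd `m` from the
finite-level functional equation of `u_m L♯ = Y_m`, the `ι`-weight `⌊p^m/(p+1)⌋` of `u_m` and
`a ≡ ⌊p^m/(p+1)⌋ (mod p^m)`). [cite: Sprung2017, Cor. 4.14 (a_p = 0 display) and §3.5] -/
theorem exists_sharp_transport_apZero
    (hint : ∀ a k : ℕ, ‖((ratPlusSymbol f ((a : ℚ) / (p : ℚ) ^ k) : ℚ) : ℚ_[p])‖ ≤ 1)
    {σ : ℤ} (hσ : σ ^ 2 = 1) (hW : IsFrickeEigen N f (-(σ : ℂ)))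
    {ηN : rootsOfUnity (torsionOrder p) ℤ_[p]} {c : ℤ_[p]}
    (hc : ∀ n : ℕ, PadicInt.toZModPow (n + cyclotomicExponent p) ((ηN : ℤ_[p]ˣ) : ℤ_[p]) *
      (cyclotomicGenerator p : ZMod (p ^ (n + cyclotomicExponent p))) ^
        (PadicInt.toZModPow n c).val = (N : ZMod (p ^ (n + cyclotomicExponent p))))
    {a : ℤ_[p]} (ha : ((p : ℤ_[p]) + 1) * a = -(p : ℤ_[p]))
    {Ls Lf : IwasawaAlgebra p} (h : IsSprungPair f p 0 Ls Lf) (m : ℕ) :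
    ∃ δ : IwasawaAlgebra p,
      toIwasawa p (sharpPoly 0 p m) *
          ((σ : IwasawaAlgebra p) * PowerSeries.binomialSeries ℤ_[p] (-(c + a)) *
            Ls.subst (invOnePlusSubOne : ℤ_[p]⟦X⟧)) -
        toIwasawa p (sharpPoly 0 p m) * Ls =
      (((cyclotomicOmega p m).map (Int.castRingHom ℤ_[p]) : Polynomial ℤ_[p]) : ℤ_[p]⟦X⟧) * δ := by
  rcases Nat.even_or_odd m with ⟨k, hk⟩ | ⟨k, hk⟩
  · have hu : sharpPoly 0 p m = 0 := by rw [hk, ← two_mul]; exact sharpPoly_zero_of_even' p k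
    exact ⟨0, by rw [hu, map_zero]; ring⟩
  · subst hk
    set n := 2 * k + 1 with hn
    set d : ℕ := p ^ n / (p + 1) with hd
    set U : IwasawaAlgebra p := toIwasawa p (sharpPoly 0 p n) with hU
    set E : IwasawaAlgebra p := (invOnePlusSubOne : ℤ_[p]⟦X⟧) + 1 with hE
    set S : IwasawaAlgebra p := Ls.subst (invOnePlusSubOne : ℤ_[p]⟦X⟧) with hS
    have hι := hasSubst_invOnePlusSubOne (R := ℤ_[p])
    -- the finite-level functional equation of `Y_n = u_n L♯` (`v_n = 0`)
    obtain ⟨e, he⟩ := h.exists_subst_sub_mul_eq_omega_mul hint hσ hW hc n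
    have hv : flatPoly 0 p n = 0 := flatPoly_zero_of_odd' p k
    rw [hv, map_zero, zero_mul, add_zero, ← coe_substAlgHom hι, map_mul, coe_substAlgHom hι,
      ← hS, ← hU] at he
    -- homogeneity of `u_n`
    have hUι : U.subst (invOnePlusSubOne : ℤ_[p]⟦X⟧) = E ^ d * U := by
      rw [hU, toIwasawa_eq_coe, subst_invOnePlusSubOne_sharpPoly_zero]
    rw [hUι] at he
    -- `a ≡ d (mod p^n)` and `(1+T)^a ≡ (1+T)^d (mod ω_n)`
    obtain ⟨q₁, hq₁⟩ := exists_binomialSeries_sub_pow_eq_omega_mul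
      (toZModPow_eq_pow_div_succ_of_odd ha k)
    rw [coe_map_cyclotomicOmega]
    rw [← hd] at hq₁
    -- units
    have hPE : (1 + X : ℤ_[p]⟦X⟧) ^ d * E ^ d = 1 := one_add_X_pow_mul_E_pow (R := ℤ_[p]) d
    have hBB : PowerSeries.binomialSeries ℤ_[p] (-(c + a)) * PowerSeries.binomialSeries ℤ_[p] c =
        PowerSeries.binomialSeries ℤ_[p] (-a) := by
      rw [← binomialSeries_add]; congr 1; ring
    have hBa : PowerSeries.binomialSeries ℤ_[p] (-a) * PowerSeries.binomialSeries ℤ_[p] a = 1 := by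
      rw [← binomialSeries_add, neg_add_cancel, binomialSeries_zero]
    have hσ2 : (σ : IwasawaAlgebra p) * (σ : IwasawaAlgebra p) = 1 := by
      have h := congrArg (Int.cast : ℤ → IwasawaAlgebra p) hσ
      push_cast at h
      rw [← sq]; exact h
    refine ⟨-(PowerSeries.binomialSeries ℤ_[p] (-a) * q₁ * U * Ls) +
      (σ : IwasawaAlgebra p) * PowerSeries.binomialSeries ℤ_[p] (-(c + a)) *
        (1 + X : ℤ_[p]⟦X⟧) ^ d * e, ?_⟩
    linear_combination ((σ : IwasawaAlgebra p) * PowerSeries.binomialSeries ℤ_[p] (-(c + a)) *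
        (1 + X : ℤ_[p]⟦X⟧) ^ d) * he -
      ((σ : IwasawaAlgebra p) * PowerSeries.binomialSeries ℤ_[p] (-(c + a)) * U * S) * hPE +
      ((1 + X : ℤ_[p]⟦X⟧) ^ d * U * Ls) * hBB -
      (PowerSeries.binomialSeries ℤ_[p] (-a) * U * Ls) * hq₁ +
      (U * Ls) * hBa +
      (PowerSeries.binomialSeries ℤ_[p] (-(c + a)) * PowerSeries.binomialSeries ℤ_[p] c *
        (1 + X : ℤ_[p]⟦X⟧) ^ d * U * Ls) * hσ2

/-- The `♭`-half of the transport, level by level: with `L' = σ·(1+T)^{−(c+b)}·L♭(T^ι)`,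
`v_m·L' − v_m·L♭ ∈ ω_m Λ` for every `m` (trivial at odd `m`, where `v_m = 0`; at even `m` from the
finite-level functional equation of `v_m L♭ = Y_m`, the `ι`-weight of `v_m` and `b ≡ ⌊p^m/(p+1)⌋ (mod p^m)`).
[cite: Sprung2017, Cor. 4.14 (a_p = 0 display) and §3.5] -/
theorem exists_flat_transport_apZero
    (hint : ∀ a k : ℕ, ‖((ratPlusSymbol f ((a : ℚ) / (p : ℚ) ^ k) : ℚ) : ℚ_[p])‖ ≤ 1)
    {σ : ℤ} (hσ : σ ^ 2 = 1) (hW : IsFrickeEigen N f (-(σ : ℂ)))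
    {ηN : rootsOfUnity (torsionOrder p) ℤ_[p]} {c : ℤ_[p]}
    (hc : ∀ n : ℕ, PadicInt.toZModPow (n + cyclotomicExponent p) ((ηN : ℤ_[p]ˣ) : ℤ_[p]) *
      (cyclotomicGenerator p : ZMod (p ^ (n + cyclotomicExponent p))) ^
        (PadicInt.toZModPow n c).val = (N : ZMod (p ^ (n + cyclotomicExponent p))))
    {b : ℤ_[p]} (hb : ((p : ℤ_[p]) + 1) * b = -1)
    {Ls Lf : IwasawaAlgebra p} (h : IsSprungPair f p 0 Ls Lf) (m : ℕ) :
    ∃ δ : IwasawaAlgebra p,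
      toIwasawa p (flatPoly 0 p m) *
          ((σ : IwasawaAlgebra p) * PowerSeries.binomialSeries ℤ_[p] (-(c + b)) *
            Lf.subst (invOnePlusSubOne : ℤ_[p]⟦X⟧)) -
        toIwasawa p (flatPoly 0 p m) * Lf =
      (((cyclotomicOmega p m).map (Int.castRingHom ℤ_[p]) : Polynomial ℤ_[p]) : ℤ_[p]⟦X⟧) * δ := by
  rcases Nat.even_or_odd m with ⟨k, hk⟩ | ⟨k, hk⟩
  · rw [← two_mul] at hk
    subst hk
    set n := 2 * k with hn
    set d : ℕ := p ^ n / (p + 1) with hd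
    set V : IwasawaAlgebra p := toIwasawa p (flatPoly 0 p n) with hV
    set E : IwasawaAlgebra p := (invOnePlusSubOne : ℤ_[p]⟦X⟧) + 1 with hE
    set S : IwasawaAlgebra p := Lf.subst (invOnePlusSubOne : ℤ_[p]⟦X⟧) with hS
    have hι := hasSubst_invOnePlusSubOne (R := ℤ_[p])
    obtain ⟨e, he⟩ := h.exists_subst_sub_mul_eq_omega_mul hint hσ hW hc n
    have hu : sharpPoly 0 p n = 0 := sharpPoly_zero_of_even' p k
    rw [hu, map_zero, zero_mul, zero_add, ← coe_substAlgHom hι, map_mul, coe_substAlgHom hι,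
      ← hS, ← hV] at he
    have hVι : V.subst (invOnePlusSubOne : ℤ_[p]⟦X⟧) = E ^ d * V := by
      rw [hV, toIwasawa_eq_coe, subst_invOnePlusSubOne_flatPoly_zero]
    rw [hVι] at he
    obtain ⟨q₁, hq₁⟩ := exists_binomialSeries_sub_pow_eq_omega_mul
      (toZModPow_eq_pow_div_succ_of_even hb k)
    rw [coe_map_cyclotomicOmega]
    rw [← hd] at hq₁
    have hPE : (1 + X : ℤ_[p]⟦X⟧) ^ d * E ^ d = 1 := one_add_X_pow_mul_E_pow (R := ℤ_[p]) d
    have hBB : PowerSeries.binomialSeries ℤ_[p] (-(c + b)) * PowerSeries.binomialSeries ℤ_[p] c =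
        PowerSeries.binomialSeries ℤ_[p] (-b) := by
      rw [← binomialSeries_add]; congr 1; ring
    have hBb : PowerSeries.binomialSeries ℤ_[p] (-b) * PowerSeries.binomialSeries ℤ_[p] b = 1 := by
      rw [← binomialSeries_add, neg_add_cancel, binomialSeries_zero]
    have hσ2 : (σ : IwasawaAlgebra p) * (σ : IwasawaAlgebra p) = 1 := by
      have h := congrArg (Int.cast : ℤ → IwasawaAlgebra p) hσ
      push_cast at h
      rw [← sq]; exact h
    refine ⟨-(PowerSeries.binomialSeries ℤ_[p] (-b) * q₁ * V * Lf) +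
      (σ : IwasawaAlgebra p) * PowerSeries.binomialSeries ℤ_[p] (-(c + b)) *
        (1 + X : ℤ_[p]⟦X⟧) ^ d * e, ?_⟩
    linear_combination ((σ : IwasawaAlgebra p) * PowerSeries.binomialSeries ℤ_[p] (-(c + b)) *
        (1 + X : ℤ_[p]⟦X⟧) ^ d) * he -
      ((σ : IwasawaAlgebra p) * PowerSeries.binomialSeries ℤ_[p] (-(c + b)) * V * S) * hPE +
      ((1 + X : ℤ_[p]⟦X⟧) ^ d * V * Lf) * hBB -
      (PowerSeries.binomialSeries ℤ_[p] (-b) * V * Lf) * hq₁ +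
      (V * Lf) * hBb +
      (PowerSeries.binomialSeries ℤ_[p] (-(c + b)) * PowerSeries.binomialSeries ℤ_[p] c *
        (1 + X : ℤ_[p]⟦X⟧) ^ d * V * Lf) * hσ2
  · have hv : flatPoly 0 p m = 0 := by rw [hk]; exact flatPoly_zero_of_odd' p k
    exact ⟨0, by rw [hv, map_zero]; ring⟩

/-- **Transport of Sprung's congruences under `T ↦ T^ι` at `a_p = 0` (any prime `p`).** Let
`f ∈ S₂(Γ₀(N))` have `p`-integral plus symbols and Fricke sign `−σ`, `c` the `p`-adic exponent of
`⟨N⟩`, and `a, b ∈ ℤ_p` with `(p+1)a = −p`, `(p+1)b = −1`. If `(L♯, L♭)` is a Sprung pair for trace `0`,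
then so is `(σ(1+T)^{−(c+a)}L♯(T^ι), σ(1+T)^{−(c+b)}L♭(T^ι))`. (The `p = 2` case is the tree's
`isSprungPair_two_zero_transport`.) [cite: Sprung2017, Thm. 1.12 and Cor. 4.4 (shape of the congruences), Cor. 4.14] -/
theorem isSprungPair_zero_transport
    (hint : ∀ a k : ℕ, ‖((ratPlusSymbol f ((a : ℚ) / (p : ℚ) ^ k) : ℚ) : ℚ_[p])‖ ≤ 1)
    {σ : ℤ} (hσ : σ ^ 2 = 1) (hW : IsFrickeEigen N f (-(σ : ℂ)))
    {ηN : rootsOfUnity (torsionOrder p) ℤ_[p]} {c : ℤ_[p]}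
    (hc : ∀ n : ℕ, PadicInt.toZModPow (n + cyclotomicExponent p) ((ηN : ℤ_[p]ˣ) : ℤ_[p]) *
      (cyclotomicGenerator p : ZMod (p ^ (n + cyclotomicExponent p))) ^
        (PadicInt.toZModPow n c).val = (N : ZMod (p ^ (n + cyclotomicExponent p))))
    {a b : ℤ_[p]} (ha : ((p : ℤ_[p]) + 1) * a = -(p : ℤ_[p])) (hb : ((p : ℤ_[p]) + 1) * b = -1)
    {Ls Lf : IwasawaAlgebra p} (h : IsSprungPair f p 0 Ls Lf) :
    IsSprungPair f p 0
      ((σ : IwasawaAlgebra p) * PowerSeries.binomialSeries ℤ_[p] (-(c + a)) *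
        Ls.subst (invOnePlusSubOne : ℤ_[p]⟦X⟧))
      ((σ : IwasawaAlgebra p) * PowerSeries.binomialSeries ℤ_[p] (-(c + b)) *
        Lf.subst (invOnePlusSubOne : ℤ_[p]⟦X⟧)) := by
  intro m
  obtain ⟨δ₁, h₁⟩ := exists_sharp_transport_apZero hint hσ hW hc ha h m
  obtain ⟨δ₂, h₂⟩ := exists_flat_transport_apZero hint hσ hW hc hb h m
  have hm : IsCongrModOmega p m (mazurTateElement f p m) (-1)
      (toIwasawa p (sharpPoly 0 p m) * Ls + toIwasawa p (flatPoly 0 p m) * Lf) := h m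
  refine hm.of_sub_eq_omega_mul (d := -(δ₁ + δ₂)) ?_
  rw [map_neg, map_one]
  linear_combination (-1 : IwasawaAlgebra p) * h₁ - h₂

end Transport

/-! ## §7. The functional equations: `cor414_sharpFlat_functionalEquation_apZero` HOLDS -/

section FunctionalEquation

variable {p : ℕ} [Fact p.Prime]

-- adapted from Literature/Barriers/BirchSwinnertonDyer/PAdicFunctionalEquationSharpFlatTwoProofs.lean §7
/-- From `L = σ(1+T)^{−x}L(T^ι)` with `σ² = 1` to `L(T^ι) = σ(1+T)^{x}L` (private plumbing). [folklore] -/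
private theorem subst_invOnePlusSubOne_eq_of_eq_mul_subst {σ : ℤ} (hσ : σ ^ 2 = 1)
    {x : ℤ_[p]} {L : IwasawaAlgebra p}
    (h : L = (σ : IwasawaAlgebra p) * PowerSeries.binomialSeries ℤ_[p] (-x) *
      L.subst (invOnePlusSubOne : ℤ_[p]⟦X⟧)) :
    L.subst (invOnePlusSubOne : ℤ_[p]⟦X⟧) =
      (σ : IwasawaAlgebra p) * PowerSeries.binomialSeries ℤ_[p] x * L := by
  have hB : PowerSeries.binomialSeries ℤ_[p] x * PowerSeries.binomialSeries ℤ_[p] (-x) =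
      (1 : ℤ_[p]⟦X⟧) := by
    rw [← binomialSeries_add, add_neg_cancel, binomialSeries_zero]
  have hσ2 : (σ : IwasawaAlgebra p) * (σ : IwasawaAlgebra p) = 1 := by
    have h := congrArg (Int.cast : ℤ → IwasawaAlgebra p) hσ
    push_cast at h
    rw [← sq]; exact h
  calc L.subst (invOnePlusSubOne : ℤ_[p]⟦X⟧)
      = ((σ : IwasawaAlgebra p) * (σ : IwasawaAlgebra p)) *
          (PowerSeries.binomialSeries ℤ_[p] x * PowerSeries.binomialSeries ℤ_[p] (-x)) *
          L.subst (invOnePlusSubOne : ℤ_[p]⟦X⟧) := by rw [hσ2, hB, one_mul, one_mul]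
    _ = (σ : IwasawaAlgebra p) * PowerSeries.binomialSeries ℤ_[p] x *
          ((σ : IwasawaAlgebra p) * PowerSeries.binomialSeries ℤ_[p] (-x) *
            L.subst (invOnePlusSubOne : ℤ_[p]⟦X⟧)) := by ring
    _ = (σ : IwasawaAlgebra p) * PowerSeries.binomialSeries ℤ_[p] x * L := by rw [← h]

/-- **`T^ι` is unique**: `(1+T)(1+ι) = 1` determines `ι = (1+T)⁻¹ − 1 = invOnePlusSubOne`
(`1+T` is a unit of `R⟦T⟧`). [cite: GreenbergLNM1716, §1 (T^ι = (1+T)^{-1} − 1)] -/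
theorem eq_invOnePlusSubOne_of_one_add_X_mul {R : Type*} [CommRing R] {ι : R⟦X⟧}
    (hι : (1 + X : R⟦X⟧) * (ι + 1) = 1) : ι = invOnePlusSubOne := by
  have hu : IsUnit (1 + X : R⟦X⟧) := by
    rw [PowerSeries.isUnit_iff_constantCoeff, map_add, map_one, constantCoeff_X, add_zero]
    exact isUnit_one
  have h := hu.mul_left_cancel (hι.trans (one_add_X_mul_invOnePlusSubOne_add_one (R := R)).symm)
  exact add_right_cancel h

/-- **Sprung 2017, Cor. 4.14 at `a_p = 0` HOLDS** — the named fact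
`cor414_sharpFlat_functionalEquation_apZero` is a theorem: for an odd prime `p`, `W/ℚ` elliptic and
globally minimal with good reduction at `p` and `a_p(W) = 0`, `f ∈ S₂(Γ₀(N))` its newform with
`w_N f = −σ f`, `c` the `p`-adic exponent of `⟨N⟩`, `(p+1)a = −p`, `(p+1)b = −1`, `(1+T)(1+T^ι) = 1`,
and every Sprung pair `(L♯, L♭)` of `f` at `p` (trace `0`):
`L♯(T^ι) = σ(1+T)^{c+a}L♯` and `L♭(T^ι) = σ(1+T)^{c+b}L♭`. Proof (not Sprung's, who passes
through the completed `L̂♯, L̂♭`): the finite-level functional equation of the Mazur–Tate elements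
(`exists_mazurTateElement_fe_integral`, MTT §I.17) transported to Sprung's combination
`Y_n = u_n L♯ + v_n L♭` (`IsSprungPair.exists_subst_sub_mul_eq_omega_mul`), the `ι`-homogeneity of
`u_n`, `v_n` of weight `⌊pⁿ/(p+1)⌋` interpolated by `a` (odd `n`) and `b` (even `n`)
(`SharpFlatFunctionalEquationApZeroWeightsProofs`), the transport `isSprungPair_zero_transport`, and
the uniqueness of the pair (`IsSprungPair.unique`, Thm. 1.12); the plus symbols are `p`-integral at
`a_p = 0`, `p` odd (`norm_ratPlusSymbol_div_pow_le_one`). The `p = 2` instance is the tree's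
`Literature.Barriers.BirchSwinnertonDyer.subst_invOnePlusSubOne_eq_of_isSprungPair_two`.
[cite: Sprung2017, Cor. 4.14 (a_p = 0 display, i = 0), §3.5 (W^±), Thm. 1.12]
[cite: MazurTateTeitelbaum1986Invent, §I.17] [cite: GreenbergLNM1716, §1 (pp. 67–68)] -/
theorem cor414_sharpFlat_functionalEquation_apZero_holds : cor414_sharpFlat_functionalEquation_apZero := by
  intro p _ W _ _ N _ f hp2 hf hgood hap σ hσ hW ηN c hc a b ha hb ι hι Ls Lf hSP
  have hιeq : ι = invOnePlusSubOne := eq_invOnePlusSubOne_of_one_add_X_mul hι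
  subst hιeq
  have hpN : ¬ p ∣ N := not_dvd_level_of_isNewformOf hf hgood
  have hap' : cuspCoeff f p = ((0 : ℤ) : ℂ) := by
    rw [cuspCoeff_eq_frobeniusTrace_of_isNewformOf_holds hf hgood, hap]
  have hint := norm_ratPlusSymbol_div_pow_le_one hp2 hf.1 hpN hap'
  have h' := isSprungPair_zero_transport hint hσ hW hc ha hb hSP
  obtain ⟨hs, hfl⟩ := IsSprungPair.unique (dvd_zero (p : ℤ)) hSP h'
  exact ⟨subst_invOnePlusSubOne_eq_of_eq_mul_subst hσ hs,
    subst_invOnePlusSubOne_eq_of_eq_mul_subst hσ hfl⟩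

end FunctionalEquation

end Literature.NumberTheory.EllipticCurves.Sprung2017

end
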